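import Summits.PneNP.PneNP.Theorems.ConvexRankGatesConvexGateBlindExactLiftingTriangleIsolationNDOffLine

/-!
# Triangle instance — THEOREM B with closeness on NONDEGENERATE rows only (`ND.isolation`, `ND.rigidity`)

Support file for crux `ConvexGateBlind` (stmt-PneNP-10680), open stub `stub_exactLifting`; prover seat 0, session 35,
memo ANALYSIS14 §3. **Theorem B_ND.** Let `t ≥ 3` and `M_t − εJ = ∑_L u_L ⊗ v_L` (`3t²` non-negative terms indexed by
the lines, each `v_L` of mean `1` on its own line). If `|u_L(x) − [L mono_x]| ≤ 10⁻⁵` for all lines `L` and all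
NONDEGENERATE rows `x` (every block two-coloured; no hypothesis on the degenerate rows), then `ε ≤ 0`; and at `ε = 0`
the column functions are exactly the line indicators. Same certificate and constants as `TriLine.master`; this is the
form the corrected bridge `…TriangleJumpGen` consumes.
-/

set_option linter.dupNamespace false -- `Summit.PneNP.PneNP.…`: summit = sub-problem (D-0017)

namespace Summit.PneNP.PneNP.Theorems.XorDoor.TriLine.ND

open Finset

noncomputable section

variable {t : ℕ} {ε η : ℝ} {u : Line t → Col t → ℝ} {v : Line t → Tri t → ℝ}

/-- **Master inequality.** For a line-labelled factorisation of `M_t − εJ` with rows `η`-close to the line pattern,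
`η ≤ 10⁻⁵`, `t ≥ 3`: `ε ≤ 0`, and if `ε = 0` then `S_off = 0`, `B = 0` and `S_on = 0` (all the slack is gone). -/
theorem master (ht : 3 ≤ t) (h : IsLineFactND t ε η u v) (hη : η ≤ 1 / 100000) :
    ε ≤ 0 ∧ (ε = 0 → Soff v = 0 ∧ Bq u = 0 ∧ Son v = 0) := by
  -- the five inequalities
  have hId := identity h
  have hA := A_ge h
  obtain ⟨hB0, hB2⟩ := B_ge h
  have hC := C_le h
  have hO := muG_mul_Son_le h (by omega)
  have hη0 := h.eta_nonneg
  have hS1 := Soff_nonneg h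
  have hS2 := Son_nonneg v
  have hBt := Bt_nonneg h
  -- constants in closed form: `T = t`, `a = t − 1`, `b = t − 2`, `P = 2^t`
  have hTpos : (0 : ℝ) < (t : ℝ) := by exact_mod_cast (show 0 < t by omega)
  have hapos : (0 : ℝ) < ((t - 1 : ℕ) : ℝ) := by exact_mod_cast (show 0 < t - 1 by omega)
  have hbpos : (0 : ℝ) < ((t - 2 : ℕ) : ℝ) := by exact_mod_cast (show 0 < t - 2 by omega)
  have hPpos : (0 : ℝ) < (2 : ℝ) ^ t := by positivity
  have hT3b : (t : ℝ) ≤ 3 * ((t - 2 : ℕ) : ℝ) := by exact_mod_cast (show t ≤ 3 * (t - 2) by omega)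
  have ha2b : ((t - 1 : ℕ) : ℝ) ≤ 2 * ((t - 2 : ℕ) : ℝ) := by exact_mod_cast (show t - 1 ≤ 2 * (t - 2) by omega)
  obtain ⟨T, hT⟩ : ∃ T : ℝ, T = (t : ℝ) := ⟨_, rfl⟩
  obtain ⟨a, ha⟩ : ∃ a : ℝ, a = ((t - 1 : ℕ) : ℝ) := ⟨_, rfl⟩
  obtain ⟨b, hb⟩ : ∃ b : ℝ, b = ((t - 2 : ℕ) : ℝ) := ⟨_, rfl⟩
  obtain ⟨P, hP⟩ : ∃ P : ℝ, P = (2 : ℝ) ^ t := ⟨_, rfl⟩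
  rw [← hT] at hTpos hT3b
  rw [← ha] at hapos ha2b
  rw [← hb] at hbpos hT3b ha2b
  rw [← hP] at hPpos
  have hK : Kmin t = a * b ^ 2 * P ^ 3 := by rw [Kmin, ← ha, ← hb, ← hP]; ring
  have hF3 : Fd t ^ 3 = a ^ 3 * P ^ 3 / 8 := by rw [Fd, ← ha, ← hP]; ring
  have hTcp : Tcp t = T * a * P / 4 := by
    have := four_mul_Tcp t; rw [← hT, ← ha, ← hP] at this; linarith
  have hM : Mq t = T * (T ^ 2 * a ^ 3 * P ^ 3) / 64 := by rw [Mq_eq, hTcp]; ring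
  have hG : muG t = b * (T ^ 2 * a ^ 3 * P ^ 3) / 1024 := by rw [muG, hTcp, ← ha, ← hb, ← hP]; ring
  have hQpos : 0 < T ^ 2 * a ^ 3 * P ^ 3 := mul_pos (mul_pos (pow_pos hTpos 2) (pow_pos hapos 3)) (pow_pos hPpos 3)
  have haPpos : 0 < a * P ^ 3 := mul_pos hapos (pow_pos hPpos 3)
  -- the three ratio inequalities
  have hTQ : T * (T ^ 2 * a ^ 3 * P ^ 3) ≤ (3 * b) * (T ^ 2 * a ^ 3 * P ^ 3) :=
    mul_le_mul_of_nonneg_right hT3b hQpos.le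
  have F1 : Mq t ≤ 48 * muG t := by rw [hM, hG]; linarith
  have F2 : T ^ 3 * Fd t ^ 3 ≤ 384 * muG t := by
    rw [hF3, hG]
    have e : T ^ 3 * (a ^ 3 * P ^ 3 / 8) = T * (T ^ 2 * a ^ 3 * P ^ 3) / 8 := by ring
    rw [e]; linarith
  have F3 : 2 * Fd t ^ 3 ≤ Kmin t := by
    rw [hF3, hK]
    have h1 : a ^ 2 ≤ (2 * b) ^ 2 := by gcongr
    have h2 : a ^ 2 * (a * P ^ 3) ≤ (2 * b) ^ 2 * (a * P ^ 3) := mul_le_mul_of_nonneg_right h1 haPpos.le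
    have e1 : 2 * (a ^ 3 * P ^ 3 / 8) = a ^ 2 * (a * P ^ 3) / 4 := by ring
    have e2 : a * b ^ 2 * P ^ 3 = (2 * b) ^ 2 * (a * P ^ 3) / 4 := by ring
    rw [e1, e2]; linarith
  have hGpos : 0 < muG t := by rw [hG]; exact div_pos (mul_pos hbpos hQpos) (by norm_num)
  have hMpos : 0 < Mq t := by rw [hM]; exact div_pos (mul_pos hTpos hQpos) (by norm_num)
  have hF3nn : 0 ≤ Fd t ^ 3 := by rw [hF3]; exact div_nonneg (mul_nonneg (pow_nonneg hapos.le 3) (pow_nonneg hPpos.le 3)) (by norm_num)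
  have hKnn : 0 ≤ Kmin t := by linarith [F3, hF3nn]
  -- (S): the on-line mass in terms of the off-line mass and `B̃`
  have m1 : Mq t * Soff v ≤ 48 * muG t * Soff v := mul_le_mul_of_nonneg_right F1 hS1
  have m2 : Mq t * Son v ≤ 48 * muG t * Son v := mul_le_mul_of_nonneg_right F1 hS2
  have m3 : η * (Mq t * Soff v) ≤ η * (48 * muG t * Soff v) := mul_le_mul_of_nonneg_left m1 hη0
  have m4 : η * (Mq t * Son v) ≤ η * (48 * muG t * Son v) := mul_le_mul_of_nonneg_left m2 hη0
  have m5 : η * (muG t * Soff v) ≤ (1 / 100000) * (muG t * Soff v) :=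
    mul_le_mul_of_nonneg_right hη (mul_nonneg hGpos.le hS1)
  have m6 : η * (muG t * Son v) ≤ (1 / 100000) * (muG t * Son v) :=
    mul_le_mul_of_nonneg_right hη (mul_nonneg hGpos.le hS2)
  have n3 : 0 ≤ muG t * Soff v := mul_nonneg hGpos.le hS1
  have n4 : 0 ≤ T * Bt u := mul_nonneg hTpos.le hBt
  have hS : muG t * Son v ≤ 577 * muG t * Soff v + 12 * T * Bt u := by
    rw [← hT] at hO; linarith
  -- main inequality from the identity
  have main1 : 512 * ε * Mq t ≤ -Kmin t * Soff v - 128 * Bq u + 128 * η * Fd t ^ 3 * (Soff v + Son v) := by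
    have := neg_le_abs (Cq u v)
    linarith
  -- clearing denominators: multiply by `T² μ₀`, substitute (S), `T³ F ≤ 384 μ₀`, `2F ≤ K`, `2 B̃ ≤ T² B`
  have hTG : 0 ≤ T ^ 2 * muG t := mul_nonneg (sq_nonneg T) hGpos.le
  have q1 : T ^ 2 * muG t * (512 * ε * Mq t)
      ≤ T ^ 2 * muG t * (-Kmin t * Soff v - 128 * Bq u + 128 * η * Fd t ^ 3 * (Soff v + Son v)) :=
    mul_le_mul_of_nonneg_left main1 hTG
  have q2 : 128 * η * T ^ 2 * Fd t ^ 3 * (muG t * Son v)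
      ≤ 128 * η * T ^ 2 * Fd t ^ 3 * (577 * muG t * Soff v + 12 * T * Bt u) :=
    mul_le_mul_of_nonneg_left hS (by
      have := mul_nonneg (mul_nonneg (mul_nonneg (by norm_num : (0 : ℝ) ≤ 128) hη0) (sq_nonneg T)) hF3nn
      exact this)
  have q3 : η * (T ^ 3 * Fd t ^ 3 * Bt u) ≤ η * (384 * muG t * Bt u) :=
    mul_le_mul_of_nonneg_left (mul_le_mul_of_nonneg_right F2 hBt) hη0
  have q4 : η * T ^ 2 * muG t * (2 * Fd t ^ 3 * Soff v) ≤ η * T ^ 2 * muG t * (Kmin t * Soff v) :=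
    mul_le_mul_of_nonneg_left (mul_le_mul_of_nonneg_right F3 hS1) (mul_nonneg (mul_nonneg hη0 (sq_nonneg T)) hGpos.le)
  have n1 : 0 ≤ T ^ 2 * muG t * Kmin t * Soff v := mul_nonneg (mul_nonneg hTG hKnn) hS1
  have q6 : η * (T ^ 2 * muG t * Kmin t * Soff v) ≤ (1 / 100000) * (T ^ 2 * muG t * Kmin t * Soff v) :=
    mul_le_mul_of_nonneg_right hη n1
  rw [← hT] at hB2
  have q5 : η * muG t * (2 * Bt u) ≤ η * muG t * (T ^ 2 * Bq u) :=
    mul_le_mul_of_nonneg_left hB2 (mul_nonneg hη0 hGpos.le)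
  have n2 : 0 ≤ muG t * T ^ 2 * Bq u := mul_nonneg (mul_nonneg hGpos.le (sq_nonneg T)) hB0
  have q7 : η * (muG t * T ^ 2 * Bq u) ≤ (1 / 100000) * (muG t * T ^ 2 * Bq u) :=
    mul_le_mul_of_nonneg_right hη n2
  -- MASTER: `512 T²μ₀M·ε + (63/100) T²μ₀K·S_off + 125 T²μ₀·B ≤ 0`
  have hmaster : (T ^ 2 * muG t * Mq t * 512) * ε + (63 / 100) * (T ^ 2 * muG t * Kmin t * Soff v)
      + 125 * (muG t * T ^ 2 * Bq u) ≤ 0 := by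
    linarith [q1, q2, q3, q4, q5, q6, q7, n1, n2]
  have hcoef : 0 < T ^ 2 * muG t * Mq t * 512 :=
    mul_pos (mul_pos (mul_pos (pow_pos hTpos 2) hGpos) hMpos) (by norm_num : (0 : ℝ) < 512)
  refine ⟨?_, fun hε => ?_⟩
  · have hfin : (T ^ 2 * muG t * Mq t * 512) * ε ≤ (T ^ 2 * muG t * Mq t * 512) * 0 := by linarith
    exact le_of_mul_le_mul_left hfin hcoef
  · rw [hε, mul_zero, zero_add] at hmaster
    have hKpos : 0 < Kmin t := by rw [hK]; exact mul_pos (mul_pos hapos (pow_pos hbpos 2)) (pow_pos hPpos 3)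
    have h1 : T ^ 2 * muG t * Kmin t * Soff v = 0 := by linarith
    have hS1z : Soff v = 0 := by
      rcases mul_eq_zero.mp h1 with h2 | h2
      · exfalso; exact (mul_pos (mul_pos (pow_pos hTpos 2) hGpos) hKpos).ne' h2
      · exact h2
    have h3 : muG t * T ^ 2 * Bq u = 0 := by linarith
    have hQz : Bq u = 0 := by
      rcases mul_eq_zero.mp h3 with h4 | h4
      · exfalso; exact (mul_pos hGpos (pow_pos hTpos 2)).ne' h4
      · exact h4
    have hBtz : Bt u = 0 := by
      have : 2 * Bt u ≤ 0 := by rw [hQz, mul_zero] at hB2; exact hB2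
      linarith
    have h5 : muG t * Son v = 0 := by
      have : muG t * Son v ≤ 0 := by rw [hS1z, hBtz] at hS; linarith
      have : 0 ≤ muG t * Son v := mul_nonneg hGpos.le hS2
      linarith
    have hS2z : Son v = 0 := by
      rcases mul_eq_zero.mp h5 with h6 | h6
      · exfalso; exact hGpos.ne' h6
      · exact h6
    exact ⟨hS1z, hQz, hS2z⟩

/-- **Isolation (abstract form).** A line-labelled factorisation of `M_t − εJ` with rows `η`-close to the line pattern,
`η ≤ 10⁻⁵`, `t ≥ 3`, has `ε ≤ 0`. -/
theorem isolation (ht : 3 ≤ t) (h : IsLineFactND t ε η u v) (hη : η ≤ 1 / 100000) : ε ≤ 0 := (master ht h hη).1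

/-- **Local rigidity (abstract form).** At `ε = 0`: a line-labelled `3t²`-term factorisation of `M_t` itself with rows
`η`-close to the line pattern (`η ≤ 10⁻⁵`, `t ≥ 3`) has EXACTLY the line indicators as its (normalised) column functions. -/
theorem rigidity (ht : 3 ≤ t) (h : IsLineFactND t 0 η u v) (hη : η ≤ 1 / 100000) : ∀ L w, v L w = lind L w := by
  obtain ⟨hS1, -, hS2⟩ := (master ht h hη).2 rfl
  intro L w
  have h1 : (1 - lind L w) * Dfn v L w = 0 := by
    have hnn : ∀ L' ∈ (univ : Finset (Line t)), 0 ≤ ∑ w' : Tri t, (1 - lind L' w') * Dfn v L' w' := by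
      intro L' _
      refine sum_nonneg fun w' _ => ?_
      by_cases hm : lmem L' w'
      · rw [lind_of_lmem hm]; simp
      · rw [lind_of_not_lmem hm]; simpa using Dfn_nonneg_of_not_lmem h hm
    have hL := (sum_eq_zero_iff_of_nonneg hnn).mp hS1 L (mem_univ L)
    have hnn' : ∀ w' ∈ (univ : Finset (Tri t)), 0 ≤ (1 - lind L w') * Dfn v L w' := by
      intro w' _
      by_cases hm : lmem L w'
      · rw [lind_of_lmem hm]; simp
      · rw [lind_of_not_lmem hm]; simpa using Dfn_nonneg_of_not_lmem h hm
    exact (sum_eq_zero_iff_of_nonneg hnn').mp hL w (mem_univ w)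
  have h2 : lind L w * |Dfn v L w| = 0 := by
    have hnn : ∀ L' ∈ (univ : Finset (Line t)), 0 ≤ ∑ w' : Tri t, lind L' w' * |Dfn v L' w'| :=
      fun L' _ => sum_nonneg fun w' _ => mul_nonneg (lind_nonneg L' w') (abs_nonneg _)
    have hL := (sum_eq_zero_iff_of_nonneg hnn).mp hS2 L (mem_univ L)
    exact (sum_eq_zero_iff_of_nonneg (fun w' _ => mul_nonneg (lind_nonneg L w') (abs_nonneg _))).mp hL w (mem_univ w)
  have h3 : Dfn v L w = 0 := by
    by_cases hm : lmem L w
    · rw [lind_of_lmem hm, one_mul] at h2; exact abs_eq_zero.mp h2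
    · rw [lind_of_not_lmem hm, sub_zero, one_mul] at h1; exact h1
  unfold Dfn at h3
  linarith

/-- **THEOREM B_ND — isolation and local rigidity of the line factorisation with closeness on nondegenerate rows only**
(registered sub-goal `triangle_nd_isolation` of stmt-PneNP-10680, verbatim signature): `t ≥ 3`, `η ≤ 10⁻⁵` ⇒ `ε ≤ 0`,
and at `ε = 0` the column functions are the line indicators. -/
theorem triangle_nd_isolation : ∀ (t : ℕ), 3 ≤ t → ∀ (ε η : ℝ) (u : Line t → Col t → ℝ) (v : Line t → Tri t → ℝ),
    IsLineFactND t ε η u v → η ≤ 1 / 100000 → ε ≤ 0 ∧ (ε = 0 → ∀ L w, v L w = lind L w) := by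
  intro t ht ε η u v h hη
  refine ⟨isolation ht h hη, fun hε => ?_⟩
  subst hε
  exact rigidity ht h hη


end

end Summit.PneNP.PneNP.Theorems.XorDoor.TriLine.ND
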